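import Literature.MathematicalPhysics.QuantumManyBody.SlidingLemmaScaled
import Literature.MathematicalPhysics.QuantumManyBody.CoulombBoxIntegrability
import HarnessLib

/-!
# Lieb–Solovej Lemma 3.2 (decoupling of boxes): the jellium energy dominates its sliding average

Topic `Literature/MathematicalPhysics/QuantumManyBody` (the charged Bose gas, `JelliumBoseGas.foldyLaw`;
first many-body step of the lower bound [LiebSolovej2001, Thm. 1.1]). [LiebSolovej2001, Lemma 3.2]
bounds the energy of an `N`-body wave function `Ψ` from below by the average, over the position
`z` of a cube `Q_z` of side `ℓ`, of localized energies:

`⟨Ψ, HΨ⟩ ≥ ℓ⁻³ ∫ dz [ ∑ⱼ ∫_{xⱼ ∈ Q_z} |∇ⱼΨ|² + γ ∫ W_z |Ψ|² ] - ω(t)N/(2ℓ)`   (first display of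
the proof, with `∑_λ ∫_μ dμ = ℓ⁻³ ∫ dz`), `W_z = ∑_{i<j} w_z(xᵢ,xⱼ) - ρ∑ⱼ∫_Λ w_z(xⱼ,y)dy + ½ρ²∬ w_z`,
`w_z(x,y) = χ_ℓ(x - z) Y_{ω/ℓ}(x - y) χ_ℓ(y - z)`, `γ = (∫χ²)⁻¹` (so `γℓ⁻³ = (∫χ_ℓ²)⁻¹`).

Its two ingredients are (i) the **kinetic tiling identity** `∑ⱼ∫|∇ⱼΨ|² = ℓ⁻³∫dz ∑ⱼ∫ 𝟙_{Q_z}(xⱼ)|∇ⱼΨ|²`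
(for every `x`, `∫ 𝟙_{Q_z}(x) dz = |Q| = ℓ³`; Tonelli) and (ii) the **sliding lemma**
[LiebSolovej2001, Lemma 3.1] (`Coulomb.sliding_lemma_jellium_box_split`) integrated against `|Ψ|²`,
with the order of the `z`- and `X`-integrations exchanged (Tonelli, on the nonnegative
particle–particle and particle–background parts separately). We prove both in the tree's
variational vocabulary (`BoseGas.TrialState`, `kineticDensity`, `JelliumBoseGas.jelliumInteraction`,
`chargedEnergy`, all `ℝ≥0∞`-valued), and the real form of the displayed inequality for every
trial state (all have finite energy, `CoulombBoxIntegrability.lean`):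

* `JelliumBoseGas.lintegral_indicator_sub`, `lintegral_sum_lintegral_indicator_mul` — tiling;
* `JelliumBoseGas.lintegral_kineticDensity_eq_tiling` — (i) for `C¹` wave functions;
* `JelliumBoseGas.lintegral_jelliumInteraction_ge_sliding` — (ii) in `ℝ≥0∞` (Tonelli form);
* `JelliumBoseGas.chargedEnergy_toReal_ge_sliding` — **[LiebSolovej2001, Lemma 3.2], first
  display**, real form, for every trial state `Ψ`.

The cube `Q` of the kinetic term is an arbitrary measurable set of volume `ℓ³` here (the source
takes `Q_z = z + [-ℓ/2, ℓ/2]³ ⊇ supp χ_ℓ(· - z)`; that choice matters only for the next step,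
[LiebSolovej2001, Lemma 3.3]).

## References

* [LiebSolovej2001] E. H. Lieb, J. P. Solovej, Commun. Math. Phys. 217 (2001) 127–163, Lemma 3.2
  and its proof (arXiv:cond-mat/0007425, pp. 8–9).
-/

noncomputable section

open MeasureTheory Set Filter Real
open scoped ENNReal NNReal Topology

namespace Literature.MathematicalPhysics.QuantumManyBody.JelliumBoseGas

open BoseGas Coulomb

/-! ### The tiling identity -/

/-- **`∫ 𝟙_Q(x - z) dz = |Q|`** for every `x` (translation and reflection invariance of Lebesgue
measure). [folklore] -/
theorem lintegral_indicator_sub (Q : Set Space) (hQ : MeasurableSet Q) (x : Space) :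
    ∫⁻ z, Q.indicator (fun _ => (1 : ℝ≥0∞)) (x - z) = volume Q := by
  rw [lintegral_sub_left_eq_self (fun z => Q.indicator (fun _ => (1 : ℝ≥0∞)) z) x]
  exact lintegral_indicator_one hQ

/-- **Tiling**: for measurable `Fⱼ ≥ 0` on configuration space and a measurable `Q ⊆ ℝ³`,
`∫ dz ∑ⱼ ∫ 𝟙_Q(xⱼ - z) Fⱼ(X) dX = |Q| ∑ⱼ ∫ Fⱼ` (Tonelli and `lintegral_indicator_sub`).
[cite: LiebSolovej2001, Lemma 3.2 (proof)] -/
theorem lintegral_sum_lintegral_indicator_mul {N : ℕ} (F : Fin N → Config N → ℝ≥0∞)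
    (hF : ∀ j, Measurable (F j)) (Q : Set Space) (hQ : MeasurableSet Q) :
    ∫⁻ z, ∑ j, ∫⁻ X, Q.indicator (fun _ => (1 : ℝ≥0∞)) (X j - z) * F j X =
      volume Q * ∑ j, ∫⁻ X, F j X := by
  have hind : Measurable (Q.indicator fun _ : Space => (1 : ℝ≥0∞)) :=
    measurable_const.indicator hQ
  have hG : ∀ j : Fin N, Measurable fun q : Space × Config N =>
      Q.indicator (fun _ => (1 : ℝ≥0∞)) (q.2 j - q.1) * F j q.2 := fun j => by
    have hsub : Measurable fun q : Space × Config N => q.2 j - q.1 :=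
      ((measurable_pi_apply j).comp measurable_snd).sub measurable_fst
    exact (hind.comp hsub).mul ((hF j).comp measurable_snd)
  have hmeas : ∀ j : Fin N, Measurable fun z : Space =>
      ∫⁻ X, Q.indicator (fun _ => (1 : ℝ≥0∞)) (X j - z) * F j X := fun j =>
    (hG j).lintegral_prod_right'
  rw [lintegral_finsetSum _ fun j _ => hmeas j, Finset.mul_sum]
  refine Finset.sum_congr rfl fun j _ => ?_
  rw [lintegral_lintegral_swap (hG j).aemeasurable]
  have hinner : ∀ X : Config N, ∫⁻ z, Q.indicator (fun _ => (1 : ℝ≥0∞)) (X j - z) * F j X =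
      volume Q * F j X := fun X => by
    have hm : Measurable fun z : Space => Q.indicator (fun _ => (1 : ℝ≥0∞)) (X j - z) :=
      hind.comp (measurable_const.sub measurable_id)
    rw [lintegral_mul_const _ hm, lintegral_indicator_sub Q hQ]
  simp_rw [hinner]
  rw [lintegral_const_mul _ (hF j)]

/-- The kinetic energy density of the `j`-th particle, `∑ₖ |∂Ψ/∂x_{j,k}|²`, is measurable for
`Ψ ∈ C¹`. [folklore] -/
theorem measurable_kineticDensityAt {N : ℕ} {ψ : Config N → ℂ} (hψ : ContDiff ℝ 1 ψ) (j : Fin N) :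
    Measurable fun X : Config N => ∑ k : Fin 3,
      (‖fderiv ℝ ψ X (Pi.single j (EuclideanSpace.single k (1 : ℝ)))‖₊ : ℝ≥0∞) ^ 2 := by
  refine Finset.measurable_sum _ fun k _ => ?_
  have hc : Continuous fun X : Config N =>
      fderiv ℝ ψ X (Pi.single j (EuclideanSpace.single k (1 : ℝ))) :=
    (hψ.continuous_fderiv one_ne_zero).clm_apply continuous_const
  exact (hc.measurable.nnnorm.coe_nnreal_ennreal).pow_const _

/-- **The kinetic tiling identity** [LiebSolovej2001, Lemma 3.2 (proof)]: for `Ψ ∈ C¹` on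
`(ℝ³)^N` and a measurable `Q ⊆ ℝ³` of positive finite volume,
`∫ |∇Ψ|² = |Q|⁻¹ ∫ dz ∑ⱼ ∫ 𝟙_Q(xⱼ - z) |∇ⱼΨ(X)|² dX` — the kinetic energy is the average over
the position of the cube of the kinetic energies of the particles inside it (no boundary
condition on `Q`: these are Neumann energies). [cite: LiebSolovej2001, Lemma 3.2] -/
theorem lintegral_kineticDensity_eq_tiling {N : ℕ} {ψ : Config N → ℂ} (hψ : ContDiff ℝ 1 ψ)
    (Q : Set Space) (hQ : MeasurableSet Q) (hQ0 : volume Q ≠ 0) (hQt : volume Q ≠ ⊤) :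
    ∫⁻ X, kineticDensity ψ X = (volume Q)⁻¹ * ∫⁻ z, ∑ j, ∫⁻ X,
      Q.indicator (fun _ => (1 : ℝ≥0∞)) (X j - z) *
        ∑ k : Fin 3, (‖fderiv ℝ ψ X (Pi.single j (EuclideanSpace.single k (1 : ℝ)))‖₊ : ℝ≥0∞) ^ 2 := by
  rw [lintegral_sum_lintegral_indicator_mul _ (measurable_kineticDensityAt hψ) Q hQ, ← mul_assoc,
    ENNReal.inv_mul_cancel hQ0 hQt, one_mul, ← lintegral_finsetSum _
      fun j _ => measurable_kineticDensityAt hψ j]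
  rfl

/-! ### An `ℝ≥0∞` bookkeeping lemma -/

/-- If `γ, A, b, B, d, u ≥ 0` and `γA + c ≤ u + bB + d` then
`ofReal γ · ofReal A + ofReal c ≤ ofReal u + ofReal b · ofReal B + ofReal d + ofReal (-c)`
(the constant `c` of unknown sign is split between the two sides). [folklore] -/
theorem ofReal_mul_add_ofReal_le {γ A b B c d u : ℝ} (hγ : 0 ≤ γ) (hA : 0 ≤ A) (hb : 0 ≤ b)
    (hB : 0 ≤ B) (hd : 0 ≤ d) (hu : 0 ≤ u) (h : γ * A + c ≤ u + b * B + d) :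
    ENNReal.ofReal γ * ENNReal.ofReal A + ENNReal.ofReal c ≤
      ENNReal.ofReal u + ENNReal.ofReal b * ENNReal.ofReal B + ENNReal.ofReal d +
        ENNReal.ofReal (-c) := by
  have hbB := mul_nonneg hb hB
  rw [← ENNReal.ofReal_mul hγ, ← ENNReal.ofReal_mul hb, ← ENNReal.ofReal_add hu hbB,
    ← ENNReal.ofReal_add (add_nonneg hu hbB) hd]
  rcases le_or_gt 0 c with hc | hc
  · rw [← ENNReal.ofReal_add (mul_nonneg hγ hA) hc, ENNReal.ofReal_of_nonpos (neg_nonpos.2 hc),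
      add_zero]
    exact ENNReal.ofReal_le_ofReal h
  · rw [ENNReal.ofReal_of_nonpos hc.le, add_zero,
      ← ENNReal.ofReal_add (add_nonneg (add_nonneg hu hbB) hd) (by linarith)]
    exact ENNReal.ofReal_le_ofReal (by linarith)

/-! ### The potential energy dominates its sliding average -/

section Sliding

variable {χ : Space → ℝ}

/-- **The jellium energy dominates its sliding average, `ℝ≥0∞` form** [LiebSolovej2001,
Lemma 3.2 (proof), potential part]: let `χ ∈ C_c^∞(ℝ³)`, `χ ≥ 0`, `∫χ² ≠ 0`, and let
`ω₀ = ω₀(χ)` be the Conlon–Lieb–Yau threshold. For `ω ≥ ω₀`, `ℓ > 0`, `ρ ≥ 0`, a box `Λ_L` and a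
trial state `Ψ` of `N` bosons in `Λ_L`, write `χ_ℓ = χ(·/ℓ)`, `γ_ℓ = (∫χ_ℓ²)⁻¹`, `Y = Y_{ω/ℓ}`,
`PP_z(X) = ∑_{i<j} χ_ℓ(xᵢ-z)Y(xᵢ-xⱼ)χ_ℓ(xⱼ-z)`, `PB_z(X) = ∑ᵢ ∫_Λ χ_ℓ(xᵢ-z)Y(xᵢ-y)χ_ℓ(y-z)dy`,
`BB_z = ∬_{Λ×Λ} χ_ℓ(x-z)Y(x-y)χ_ℓ(y-z)`, `C = ½ρ²γ_ℓ∫BB_z dz + jelliumEnergyShift 1 ρ N L`. Then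
`γ_ℓ ∫dz ∫ PP_z|Ψ|² + C ≤ ∫ jelliumInteraction·|Ψ|² + ργ_ℓ ∫dz ∫ PB_z|Ψ|² + ½(ω/ℓ)N + (-C)`
in `ℝ≥0∞` (`ofReal` of each real scalar; `ofReal C - ofReal (-C) = C`), i.e. the sliding lemma
`Coulomb.sliding_lemma_jellium_box_split` integrated against `|Ψ|²` with the `z`- and
`X`-integrals exchanged (Tonelli on the nonnegative `PP`, `PB` parts).
[cite: LiebSolovej2001, Lemma 3.2] -/
theorem lintegral_jelliumInteraction_ge_sliding (hχ : ContDiff ℝ (⊤ : ℕ∞) χ)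
    (hsupp : HasCompactSupport χ) (hχ0 : (∫ u, χ u ^ 2) ≠ 0) (hχnn : ∀ x, 0 ≤ χ x) :
    ∃ ω₀ : ℝ, 0 < ω₀ ∧ ∀ ω : ℝ, ω₀ ≤ ω → ∀ ℓ : ℝ, 0 < ℓ → ∀ ρ : ℝ, 0 ≤ ρ → ∀ (L : ℝ) {N : ℕ}
      (Ψ : TrialState N L),
        ENNReal.ofReal (∫ u, χ (ℓ⁻¹ • u) ^ 2)⁻¹ * (∫⁻ z : Space, ∫⁻ X : Config N,
            ENNReal.ofReal (∑ i, ∑ j with i < j, χ (ℓ⁻¹ • (X i - z)) *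
            (Real.exp (-(ω / ℓ * ‖X i - X j‖)) / ‖X i - X j‖) * χ (ℓ⁻¹ • (X j - z))) * (‖Ψ.ψ X‖₊ : ℝ≥0∞) ^ 2) +
          ENNReal.ofReal (ρ ^ 2 / 2 * ((∫ u, χ (ℓ⁻¹ • u) ^ 2)⁻¹ * ∫ z : Space, ∫ q in box L ×ˢ box L, χ (ℓ⁻¹ • (q.1 - z)) *
            (Real.exp (-(ω / ℓ * ‖q.1 - q.2‖)) / ‖q.1 - q.2‖) * χ (ℓ⁻¹ • (q.2 - z)) ∂(volume.prod volume)) +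
            jelliumEnergyShift 1 ρ N L) ≤
        (∫⁻ X, jelliumInteraction ρ N L X * (‖Ψ.ψ X‖₊ : ℝ≥0∞) ^ 2) +
          ENNReal.ofReal (ρ * (∫ u, χ (ℓ⁻¹ • u) ^ 2)⁻¹) * (∫⁻ z : Space, ∫⁻ X : Config N,
            ENNReal.ofReal (∑ i, ∫ y in box L, χ (ℓ⁻¹ • (X i - z)) *
            (Real.exp (-(ω / ℓ * ‖X i - y‖)) / ‖X i - y‖) * χ (ℓ⁻¹ • (y - z))) * (‖Ψ.ψ X‖₊ : ℝ≥0∞) ^ 2) +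
          ENNReal.ofReal (1 / 2 * (ω / ℓ) * N) +
          ENNReal.ofReal (-(ρ ^ 2 / 2 * ((∫ u, χ (ℓ⁻¹ • u) ^ 2)⁻¹ * ∫ z : Space, ∫ q in box L ×ˢ box L, χ (ℓ⁻¹ • (q.1 - z)) *
            (Real.exp (-(ω / ℓ * ‖q.1 - q.2‖)) / ‖q.1 - q.2‖) * χ (ℓ⁻¹ • (q.2 - z)) ∂(volume.prod volume)) +
            jelliumEnergyShift 1 ρ N L)) := by
  obtain ⟨ω₀, hω₀, H⟩ := sliding_lemma_jellium_box_split hχ hsupp hχ0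
  refine ⟨ω₀, hω₀, fun ω hω ℓ hℓ ρ hρ L N Ψ => ?_⟩
  have hν : 0 < ω / ℓ := div_pos (hω₀.trans_le hω) hℓ
  have hχℓ : Continuous fun x : Space => χ (ℓ⁻¹ • x) :=
    hχ.continuous.comp (continuous_const_smul _)
  have hsuppℓ : HasCompactSupport fun x : Space => χ (ℓ⁻¹ • x) :=
    hsupp.comp_smul (inv_ne_zero hℓ.ne')
  have hγ0 : 0 ≤ (∫ u, χ (ℓ⁻¹ • u) ^ 2)⁻¹ := inv_nonneg.2 (integral_nonneg fun u => sq_nonneg _)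
  have hd0 : (0 : ℝ) ≤ 1 / 2 * (ω / ℓ) * N := by positivity
  have hY0 : ∀ x : Space, 0 ≤ Real.exp (-(ω / ℓ * ‖x‖)) / ‖x‖ := fun x =>
    div_nonneg (Real.exp_pos _).le (norm_nonneg _)
  -- nonnegativity of the sliding terms
  have hPPnn : ∀ (X : Config N) (z : Space), 0 ≤ ∑ i, ∑ j with i < j, χ (ℓ⁻¹ • (X i - z)) *
            (Real.exp (-(ω / ℓ * ‖X i - X j‖)) / ‖X i - X j‖) * χ (ℓ⁻¹ • (X j - z)) := fun X z =>
    Finset.sum_nonneg fun i _ => Finset.sum_nonneg fun j _ =>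
      mul_nonneg (mul_nonneg (hχnn _) (hY0 _)) (hχnn _)
  have hPBnn : ∀ (X : Config N) (z : Space), 0 ≤ ∑ i, ∫ y in box L, χ (ℓ⁻¹ • (X i - z)) *
            (Real.exp (-(ω / ℓ * ‖X i - y‖)) / ‖X i - y‖) * χ (ℓ⁻¹ • (y - z)) := fun X z =>
    Finset.sum_nonneg fun i _ => setIntegral_nonneg (measurableSet_box L) fun y _ =>
      mul_nonneg (mul_nonneg (hχnn _) (hY0 _)) (hχnn _)
  -- integrability in `z`
  have hPPi : ∀ X : Config N, Integrable fun z : Space => ∑ i, ∑ j with i < j, χ (ℓ⁻¹ • (X i - z)) *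
            (Real.exp (-(ω / ℓ * ‖X i - X j‖)) / ‖X i - X j‖) * χ (ℓ⁻¹ • (X j - z)) := fun X =>
    integrable_sliding_pp hχℓ hsuppℓ (fun i j => Real.exp (-(ω / ℓ * ‖X i - X j‖)) / ‖X i - X j‖) X
  have hPBi : ∀ X : Config N, Integrable fun z : Space => ∑ i, ∫ y in box L, χ (ℓ⁻¹ • (X i - z)) *
            (Real.exp (-(ω / ℓ * ‖X i - y‖)) / ‖X i - y‖) * χ (ℓ⁻¹ • (y - z)) := fun X =>
    integrable_finsetSum _ fun i _ => integrable_sliding_pb_box hχℓ hsuppℓ hν L (X i)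
  -- measurability
  have hYm : Measurable fun x : Space => Real.exp (-(ω / ℓ * ‖x‖)) / ‖x‖ :=
    (Real.measurable_exp.comp (measurable_const.mul measurable_norm).neg).div measurable_norm
  have hχm : Measurable fun x : Space => χ (ℓ⁻¹ • x) := hχℓ.measurable
  have hm1 : ∀ i : Fin N, Measurable fun q : Config N × Space => ℓ⁻¹ • (q.1 i - q.2) := fun i =>
    (((measurable_pi_apply i).comp measurable_fst).sub measurable_snd).const_smul ℓ⁻¹
  have hm2 : ∀ i j : Fin N, Measurable fun q : Config N × Space => q.1 i - q.1 j := fun i j =>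
    ((measurable_pi_apply i).comp measurable_fst).sub ((measurable_pi_apply j).comp measurable_fst)
  have hPPm : Measurable fun q : Config N × Space => ∑ i, ∑ j with i < j, χ (ℓ⁻¹ • (q.1 i - q.2)) *
            (Real.exp (-(ω / ℓ * ‖q.1 i - q.1 j‖)) / ‖q.1 i - q.1 j‖) * χ (ℓ⁻¹ • (q.1 j - q.2)) :=
    Finset.measurable_sum _ fun i _ => Finset.measurable_sum _ fun j _ =>
      ((hχ.continuous.measurable.comp (hm1 i)).mul (hYm.comp (hm2 i j))).mul
        (hχ.continuous.measurable.comp (hm1 j))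
  have hm3 : ∀ i : Fin N, Measurable fun p : (Config N × Space) × Space => p.1.1 i - p.2 :=
    fun i => ((measurable_pi_apply i).comp (measurable_fst.comp measurable_fst)).sub measurable_snd
  have hm4 : Measurable fun p : (Config N × Space) × Space => ℓ⁻¹ • (p.2 - p.1.2) :=
    (measurable_snd.sub (measurable_snd.comp measurable_fst)).const_smul ℓ⁻¹
  have hm5 : ∀ i : Fin N, Measurable fun p : (Config N × Space) × Space =>
      ℓ⁻¹ • (p.1.1 i - p.1.2) := fun i =>
    (((measurable_pi_apply i).comp (measurable_fst.comp measurable_fst)).sub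
      (measurable_snd.comp measurable_fst)).const_smul ℓ⁻¹
  have hPBm : Measurable fun q : Config N × Space => ∑ i, ∫ y in box L, χ (ℓ⁻¹ • (q.1 i - q.2)) *
            (Real.exp (-(ω / ℓ * ‖q.1 i - y‖)) / ‖q.1 i - y‖) * χ (ℓ⁻¹ • (y - q.2)) := by
    refine Finset.measurable_sum _ fun i _ => ?_
    have hf : Measurable fun p : (Config N × Space) × Space =>
        χ (ℓ⁻¹ • (p.1.1 i - p.1.2)) * (Real.exp (-(ω / ℓ * ‖p.1.1 i - p.2‖)) / ‖p.1.1 i - p.2‖) *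
          χ (ℓ⁻¹ • (p.2 - p.1.2)) :=
      ((hχ.continuous.measurable.comp (hm5 i)).mul (hYm.comp (hm3 i))).mul
        (hχ.continuous.measurable.comp hm4)
    exact (hf.stronglyMeasurable.integral_prod_right' (ν := volume.restrict (box L))).measurable
  have hw : Measurable fun X : Config N => (‖Ψ.ψ X‖₊ : ℝ≥0∞) ^ 2 :=
    (Ψ.contDiff.continuous.measurable.nnnorm.coe_nnreal_ennreal).pow_const _
  have hIPPm : Measurable fun X : Config N => ∫ z : Space, ∑ i, ∑ j with i < j, χ (ℓ⁻¹ • (X i - z)) *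
            (Real.exp (-(ω / ℓ * ‖X i - X j‖)) / ‖X i - X j‖) * χ (ℓ⁻¹ • (X j - z)) :=
    (hPPm.stronglyMeasurable.integral_prod_right' (ν := (volume : Measure Space))).measurable
  have hIPBm : Measurable fun X : Config N => ∫ z : Space, ∑ i, ∫ y in box L, χ (ℓ⁻¹ • (X i - z)) *
            (Real.exp (-(ω / ℓ * ‖X i - y‖)) / ‖X i - y‖) * χ (ℓ⁻¹ • (y - z)) :=
    (hPBm.stronglyMeasurable.integral_prod_right' (ν := (volume : Measure Space))).measurable
  -- Tonelli
  have hTPP : ∫⁻ z : Space, ∫⁻ X : Config N, ENNReal.ofReal (∑ i, ∑ j with i < j, χ (ℓ⁻¹ • (X i - z)) *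
            (Real.exp (-(ω / ℓ * ‖X i - X j‖)) / ‖X i - X j‖) * χ (ℓ⁻¹ • (X j - z))) * (‖Ψ.ψ X‖₊ : ℝ≥0∞) ^ 2 =
      ∫⁻ X : Config N, ENNReal.ofReal (∫ z : Space, ∑ i, ∑ j with i < j, χ (ℓ⁻¹ • (X i - z)) *
            (Real.exp (-(ω / ℓ * ‖X i - X j‖)) / ‖X i - X j‖) * χ (ℓ⁻¹ • (X j - z))) * (‖Ψ.ψ X‖₊ : ℝ≥0∞) ^ 2 := by
    rw [lintegral_lintegral_swap (((hPPm.comp measurable_swap).ennreal_ofReal.mul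
      (hw.comp measurable_snd)).aemeasurable)]
    refine lintegral_congr fun X => ?_
    rw [lintegral_mul_const' _ _ (ENNReal.pow_ne_top ENNReal.coe_ne_top),
      ← ofReal_integral_eq_lintegral_ofReal (hPPi X) (Eventually.of_forall (hPPnn X))]
  have hTPB : ∫⁻ z : Space, ∫⁻ X : Config N, ENNReal.ofReal (∑ i, ∫ y in box L, χ (ℓ⁻¹ • (X i - z)) *
            (Real.exp (-(ω / ℓ * ‖X i - y‖)) / ‖X i - y‖) * χ (ℓ⁻¹ • (y - z))) * (‖Ψ.ψ X‖₊ : ℝ≥0∞) ^ 2 =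
      ∫⁻ X : Config N, ENNReal.ofReal (∫ z : Space, ∑ i, ∫ y in box L, χ (ℓ⁻¹ • (X i - z)) *
            (Real.exp (-(ω / ℓ * ‖X i - y‖)) / ‖X i - y‖) * χ (ℓ⁻¹ • (y - z))) * (‖Ψ.ψ X‖₊ : ℝ≥0∞) ^ 2 := by
    rw [lintegral_lintegral_swap (((hPBm.comp measurable_swap).ennreal_ofReal.mul
      (hw.comp measurable_snd)).aemeasurable)]
    refine lintegral_congr fun X => ?_
    rw [lintegral_mul_const' _ _ (ENNReal.pow_ne_top ENNReal.coe_ne_top),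
      ← ofReal_integral_eq_lintegral_ofReal (hPBi X) (Eventually.of_forall (hPBnn X))]
  -- the pointwise inequality, multiplied by `|Ψ|²`
  have hpt : ∀ᵐ X : Config N ∂volume,
      (ENNReal.ofReal (∫ u, χ (ℓ⁻¹ • u) ^ 2)⁻¹ * ENNReal.ofReal (∫ z : Space, ∑ i, ∑ j with i < j, χ (ℓ⁻¹ • (X i - z)) *
            (Real.exp (-(ω / ℓ * ‖X i - X j‖)) / ‖X i - X j‖) * χ (ℓ⁻¹ • (X j - z))) +
          ENNReal.ofReal (ρ ^ 2 / 2 * ((∫ u, χ (ℓ⁻¹ • u) ^ 2)⁻¹ * ∫ z : Space, ∫ q in box L ×ˢ box L, χ (ℓ⁻¹ • (q.1 - z)) *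
            (Real.exp (-(ω / ℓ * ‖q.1 - q.2‖)) / ‖q.1 - q.2‖) * χ (ℓ⁻¹ • (q.2 - z)) ∂(volume.prod volume)) +
            jelliumEnergyShift 1 ρ N L)) * (‖Ψ.ψ X‖₊ : ℝ≥0∞) ^ 2 ≤
        (jelliumInteraction ρ N L X +
          ENNReal.ofReal (ρ * (∫ u, χ (ℓ⁻¹ • u) ^ 2)⁻¹) * ENNReal.ofReal (∫ z : Space, ∑ i, ∫ y in box L, χ (ℓ⁻¹ • (X i - z)) *
            (Real.exp (-(ω / ℓ * ‖X i - y‖)) / ‖X i - y‖) * χ (ℓ⁻¹ • (y - z))) +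
          ENNReal.ofReal (1 / 2 * (ω / ℓ) * N) +
          ENNReal.ofReal (-(ρ ^ 2 / 2 * ((∫ u, χ (ℓ⁻¹ • u) ^ 2)⁻¹ * ∫ z : Space, ∫ q in box L ×ˢ box L, χ (ℓ⁻¹ • (q.1 - z)) *
            (Real.exp (-(ω / ℓ * ‖q.1 - q.2‖)) / ‖q.1 - q.2‖) * χ (ℓ⁻¹ • (q.2 - z)) ∂(volume.prod volume)) +
            jelliumEnergyShift 1 ρ N L))) * (‖Ψ.ψ X‖₊ : ℝ≥0∞) ^ 2 := by
    filter_upwards [ae_injective N] with X hX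
    by_cases hXb : X ∈ boxN N L
    · refine mul_le_mul' ?_ le_rfl
      have h1 := H ω hω ℓ hℓ ρ L hX
      have hr : 0 ≤ ((∑ i, ∑ j with i < j, ‖X i - X j‖⁻¹) -
          ρ * ∑ i, backgroundPotential L (X i) + backgroundSelfEnergy ρ L) +
          jelliumEnergyShift 1 ρ N L := by
        rw [← shiftedCoulomb_eq]
        exact add_nonneg (Finset.sum_nonneg fun i _ => Finset.sum_nonneg fun j _ =>
          inv_nonneg.2 (norm_nonneg _)) (Finset.sum_nonneg fun i _ => oneBody_nonneg hρ (hXb i))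
      rw [jelliumInteraction_eq_ofReal hρ hXb, shiftedCoulomb_eq]
      exact ofReal_mul_add_ofReal_le hγ0 (integral_nonneg (hPPnn X)) (mul_nonneg hρ hγ0)
        (integral_nonneg (hPBnn X)) hd0 hr (by linarith)
    · rw [Ψ.eq_zero X hXb]
      simp
  -- assemble
  have hmC : Measurable fun X : Config N => ENNReal.ofReal (ρ ^ 2 / 2 * ((∫ u, χ (ℓ⁻¹ • u) ^ 2)⁻¹ * ∫ z : Space, ∫ q in box L ×ˢ box L, χ (ℓ⁻¹ • (q.1 - z)) *
            (Real.exp (-(ω / ℓ * ‖q.1 - q.2‖)) / ‖q.1 - q.2‖) * χ (ℓ⁻¹ • (q.2 - z)) ∂(volume.prod volume)) +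
            jelliumEnergyShift 1 ρ N L) * (‖Ψ.ψ X‖₊ : ℝ≥0∞) ^ 2 :=
    measurable_const.mul hw
  have hmD : Measurable fun X : Config N => ENNReal.ofReal (1 / 2 * (ω / ℓ) * N) * (‖Ψ.ψ X‖₊ : ℝ≥0∞) ^ 2 :=
    measurable_const.mul hw
  have hmE : Measurable fun X : Config N => ENNReal.ofReal (-(ρ ^ 2 / 2 * ((∫ u, χ (ℓ⁻¹ • u) ^ 2)⁻¹ * ∫ z : Space, ∫ q in box L ×ˢ box L, χ (ℓ⁻¹ • (q.1 - z)) *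
            (Real.exp (-(ω / ℓ * ‖q.1 - q.2‖)) / ‖q.1 - q.2‖) * χ (ℓ⁻¹ • (q.2 - z)) ∂(volume.prod volume)) +
            jelliumEnergyShift 1 ρ N L)) * (‖Ψ.ψ X‖₊ : ℝ≥0∞) ^ 2 :=
    measurable_const.mul hw
  have hmB : Measurable fun X : Config N =>
      ENNReal.ofReal (ρ * (∫ u, χ (ℓ⁻¹ • u) ^ 2)⁻¹) * ENNReal.ofReal (∫ z : Space, ∑ i, ∫ y in box L, χ (ℓ⁻¹ • (X i - z)) *
            (Real.exp (-(ω / ℓ * ‖X i - y‖)) / ‖X i - y‖) * χ (ℓ⁻¹ • (y - z))) * (‖Ψ.ψ X‖₊ : ℝ≥0∞) ^ 2 :=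
    (measurable_const.mul hIPBm.ennreal_ofReal).mul hw
  have hL : ENNReal.ofReal (∫ u, χ (ℓ⁻¹ • u) ^ 2)⁻¹ * (∫⁻ z : Space, ∫⁻ X : Config N,
        ENNReal.ofReal (∑ i, ∑ j with i < j, χ (ℓ⁻¹ • (X i - z)) *
            (Real.exp (-(ω / ℓ * ‖X i - X j‖)) / ‖X i - X j‖) * χ (ℓ⁻¹ • (X j - z))) * (‖Ψ.ψ X‖₊ : ℝ≥0∞) ^ 2) + ENNReal.ofReal (ρ ^ 2 / 2 * ((∫ u, χ (ℓ⁻¹ • u) ^ 2)⁻¹ * ∫ z : Space, ∫ q in box L ×ˢ box L, χ (ℓ⁻¹ • (q.1 - z)) *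
            (Real.exp (-(ω / ℓ * ‖q.1 - q.2‖)) / ‖q.1 - q.2‖) * χ (ℓ⁻¹ • (q.2 - z)) ∂(volume.prod volume)) +
            jelliumEnergyShift 1 ρ N L) =
      ∫⁻ X : Config N, (ENNReal.ofReal (∫ u, χ (ℓ⁻¹ • u) ^ 2)⁻¹ * ENNReal.ofReal (∫ z : Space, ∑ i, ∑ j with i < j, χ (ℓ⁻¹ • (X i - z)) *
            (Real.exp (-(ω / ℓ * ‖X i - X j‖)) / ‖X i - X j‖) * χ (ℓ⁻¹ • (X j - z))) +
          ENNReal.ofReal (ρ ^ 2 / 2 * ((∫ u, χ (ℓ⁻¹ • u) ^ 2)⁻¹ * ∫ z : Space, ∫ q in box L ×ˢ box L, χ (ℓ⁻¹ • (q.1 - z)) *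
            (Real.exp (-(ω / ℓ * ‖q.1 - q.2‖)) / ‖q.1 - q.2‖) * χ (ℓ⁻¹ • (q.2 - z)) ∂(volume.prod volume)) +
            jelliumEnergyShift 1 ρ N L)) * (‖Ψ.ψ X‖₊ : ℝ≥0∞) ^ 2 := by
    rw [hTPP, ← lintegral_const_mul' _ _ ENNReal.ofReal_ne_top]
    simp_rw [add_mul]
    rw [lintegral_add_right _ hmC, lintegral_const_mul _ hw, Ψ.norm_eq, mul_one]
    simp_rw [mul_assoc]
  have hR : (∫⁻ X, jelliumInteraction ρ N L X * (‖Ψ.ψ X‖₊ : ℝ≥0∞) ^ 2) +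
        ENNReal.ofReal (ρ * (∫ u, χ (ℓ⁻¹ • u) ^ 2)⁻¹) * (∫⁻ z : Space, ∫⁻ X : Config N,
          ENNReal.ofReal (∑ i, ∫ y in box L, χ (ℓ⁻¹ • (X i - z)) *
            (Real.exp (-(ω / ℓ * ‖X i - y‖)) / ‖X i - y‖) * χ (ℓ⁻¹ • (y - z))) * (‖Ψ.ψ X‖₊ : ℝ≥0∞) ^ 2) +
        ENNReal.ofReal (1 / 2 * (ω / ℓ) * N) + ENNReal.ofReal (-(ρ ^ 2 / 2 * ((∫ u, χ (ℓ⁻¹ • u) ^ 2)⁻¹ * ∫ z : Space, ∫ q in box L ×ˢ box L, χ (ℓ⁻¹ • (q.1 - z)) *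
            (Real.exp (-(ω / ℓ * ‖q.1 - q.2‖)) / ‖q.1 - q.2‖) * χ (ℓ⁻¹ • (q.2 - z)) ∂(volume.prod volume)) +
            jelliumEnergyShift 1 ρ N L)) =
      ∫⁻ X : Config N, (jelliumInteraction ρ N L X +
          ENNReal.ofReal (ρ * (∫ u, χ (ℓ⁻¹ • u) ^ 2)⁻¹) * ENNReal.ofReal (∫ z : Space, ∑ i, ∫ y in box L, χ (ℓ⁻¹ • (X i - z)) *
            (Real.exp (-(ω / ℓ * ‖X i - y‖)) / ‖X i - y‖) * χ (ℓ⁻¹ • (y - z))) +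
          ENNReal.ofReal (1 / 2 * (ω / ℓ) * N) +
          ENNReal.ofReal (-(ρ ^ 2 / 2 * ((∫ u, χ (ℓ⁻¹ • u) ^ 2)⁻¹ * ∫ z : Space, ∫ q in box L ×ˢ box L, χ (ℓ⁻¹ • (q.1 - z)) *
            (Real.exp (-(ω / ℓ * ‖q.1 - q.2‖)) / ‖q.1 - q.2‖) * χ (ℓ⁻¹ • (q.2 - z)) ∂(volume.prod volume)) +
            jelliumEnergyShift 1 ρ N L))) * (‖Ψ.ψ X‖₊ : ℝ≥0∞) ^ 2 := by
    rw [hTPB, ← lintegral_const_mul' _ _ ENNReal.ofReal_ne_top]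
    simp_rw [add_mul]
    rw [lintegral_add_right _ hmE, lintegral_add_right _ hmD, lintegral_add_right _ hmB,
      lintegral_const_mul _ hw, lintegral_const_mul _ hw, Ψ.norm_eq, mul_one, mul_one]
    simp_rw [mul_assoc]
  rw [hL, hR]
  exact lintegral_mono_ae hpt

/-! ### A uniform bound on the particle–background sliding term -/

/-- `∫ dz ∑ᵢ ∫_Λ χ(xᵢ - z) Y_ν(xᵢ - y) χ(y - z) dy ≤ N · M · ‖Y_ν‖₁ · ∫χ` for `0 ≤ χ ≤ M` continuous
with compact support. [folklore] -/
theorem integral_sum_sliding_pb_le {χ : Space → ℝ} (hχ : Continuous χ) (hsupp : HasCompactSupport χ)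
    (hχnn : ∀ x, 0 ≤ χ x) {M : ℝ} (hM : ∀ x, χ x ≤ M) {ν : ℝ} (hν : 0 < ν) (L : ℝ) {N : ℕ}
    (X : Fin N → Space) :
    ∫ z, ∑ i, ∫ y in box L, χ (X i - z) * (Real.exp (-(ν * ‖X i - y‖)) / ‖X i - y‖) * χ (y - z) ≤
      N * (M * (∫ x : Space, Real.exp (-(ν * ‖x‖)) / ‖x‖) * ∫ u, χ u) := by
  have hYi := integrable_yukawa_exp hν
  have hY0 : ∀ x : Space, 0 ≤ Real.exp (-(ν * ‖x‖)) / ‖x‖ := fun x =>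
    div_nonneg (Real.exp_pos _).le (norm_nonneg _)
  have hM0 : 0 ≤ M := (hχnn 0).trans (hM 0)
  set IY : ℝ := ∫ x : Space, Real.exp (-(ν * ‖x‖)) / ‖x‖ with hIY
  have hIY0 : 0 ≤ IY := integral_nonneg hY0
  have hχi : Integrable χ := hχ.integrable_of_hasCompactSupport hsupp
  -- pointwise bound
  have hpt : ∀ (z : Space) (i : Fin N),
      ∫ y in box L, χ (X i - z) * (Real.exp (-(ν * ‖X i - y‖)) / ‖X i - y‖) * χ (y - z) ≤
        χ (X i - z) * (M * IY) := by
    intro z i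
    have hYx : Integrable fun y : Space => Real.exp (-(ν * ‖X i - y‖)) / ‖X i - y‖ :=
      hYi.comp_sub_left (X i)
    calc ∫ y in box L, χ (X i - z) * (Real.exp (-(ν * ‖X i - y‖)) / ‖X i - y‖) * χ (y - z)
        ≤ ∫ y in box L, χ (X i - z) * M * (Real.exp (-(ν * ‖X i - y‖)) / ‖X i - y‖) := by
          refine integral_mono_of_nonneg (Eventually.of_forall fun y =>
            mul_nonneg (mul_nonneg (hχnn _) (hY0 _)) (hχnn _)) ((hYx.const_mul _).integrableOn)
            (Eventually.of_forall fun y => ?_)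
          have h1 := hM (y - z)
          have h2 := hχnn (X i - z)
          have h3 := hY0 (X i - y)
          calc χ (X i - z) * (Real.exp (-(ν * ‖X i - y‖)) / ‖X i - y‖) * χ (y - z)
              ≤ χ (X i - z) * (Real.exp (-(ν * ‖X i - y‖)) / ‖X i - y‖) * M :=
                mul_le_mul_of_nonneg_left h1 (mul_nonneg h2 h3)
            _ = χ (X i - z) * M * (Real.exp (-(ν * ‖X i - y‖)) / ‖X i - y‖) := by ring
      _ = χ (X i - z) * M * ∫ y in box L, Real.exp (-(ν * ‖X i - y‖)) / ‖X i - y‖ :=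
          integral_const_mul _ _
      _ ≤ χ (X i - z) * M * IY := by
          refine mul_le_mul_of_nonneg_left ?_ (mul_nonneg (hχnn _) hM0)
          calc ∫ y in box L, Real.exp (-(ν * ‖X i - y‖)) / ‖X i - y‖
              ≤ ∫ y, Real.exp (-(ν * ‖X i - y‖)) / ‖X i - y‖ :=
                setIntegral_le_integral hYx (Eventually.of_forall fun y => hY0 _)
            _ = IY := integral_sub_left_eq_self (fun x : Space => Real.exp (-(ν * ‖x‖)) / ‖x‖) volume (X i)
      _ = χ (X i - z) * (M * IY) := by ring
  -- integrate in `z`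
  have hLi : Integrable fun z : Space => ∑ i, ∫ y in box L,
      χ (X i - z) * (Real.exp (-(ν * ‖X i - y‖)) / ‖X i - y‖) * χ (y - z) :=
    integrable_finsetSum _ fun i _ => integrable_sliding_pb_box hχ hsupp hν L (X i)
  have hRi : Integrable fun z : Space => ∑ i, χ (X i - z) * (M * IY) :=
    integrable_finsetSum _ fun i _ => (hχi.comp_sub_left (X i)).mul_const _
  calc ∫ z, ∑ i, ∫ y in box L, χ (X i - z) * (Real.exp (-(ν * ‖X i - y‖)) / ‖X i - y‖) * χ (y - z)
      ≤ ∫ z, ∑ i, χ (X i - z) * (M * IY) :=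
        integral_mono hLi hRi fun z => Finset.sum_le_sum fun i _ => hpt z i
    _ = ∑ i : Fin N, (M * IY) * ∫ u, χ u := by
        rw [integral_finsetSum _ fun i _ => (hχi.comp_sub_left (X i)).mul_const _]
        refine Finset.sum_congr rfl fun i _ => ?_
        rw [integral_mul_const, integral_sub_left_eq_self χ volume (X i), mul_comm]
    _ = N * (M * IY * ∫ u, χ u) := by
        rw [Finset.sum_const, Finset.card_univ, Fintype.card_fin, nsmul_eq_mul, mul_assoc]

/-! ### Lemma 3.2, real form -/

/-- **[LiebSolovej2001, Lemma 3.2] (decoupling of boxes), first display of the proof**, in the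
tree's vocabulary (`ħ = 2m = 1`, Coulomb coupling `q`): with `χ`, `ω₀(χ)`, `χ_ℓ`, `γ_ℓ`, `Y`,
`PP_z`, `PB_z`, `BB_z` as in `lintegral_jelliumInteraction_ge_sliding`, for `ω ≥ ω₀`, `ℓ > 0`,
`ρ ≥ 0`, `q > 0` and every trial state `Ψ` (its energy is finite,
`chargedEnergy_ne_top`), the sliding averages
`I_PP = ∫dz ∫PP_z|Ψ|²`, `I_PB = ∫dz ∫PB_z|Ψ|²` are finite and
`∫|∇Ψ|² + q (γ_ℓ I_PP - ρ γ_ℓ I_PB + ½ρ² γ_ℓ ∫BB_z dz) - q ω N/(2ℓ) ≤ ⟨Ψ, H Ψ⟩`,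
where `⟨Ψ, HΨ⟩ = (chargedEnergy 0 q ρ Ψ).toReal - jelliumEnergyShift q ρ N L` is the energy of
LSSY's `H_N^{(1)}` (10.1) and the kinetic term is the tiling average `ℓ⁻³∫dz ∑ⱼ∫𝟙_{Q_z}(xⱼ)|∇ⱼΨ|²`
by `lintegral_kineticDensity_eq_tiling`. (The source states this for `Ψ` on all of `ℝ³ᴺ`; Dirichlet
conditions on `Λ_L` only raise the energy.) [cite: LiebSolovej2001, Lemma 3.2] -/
theorem chargedEnergy_toReal_ge_sliding (hχ : ContDiff ℝ (⊤ : ℕ∞) χ)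
    (hsupp : HasCompactSupport χ) (hχ0 : (∫ u, χ u ^ 2) ≠ 0) (hχnn : ∀ x, 0 ≤ χ x) :
    ∃ ω₀ : ℝ, 0 < ω₀ ∧ ∀ ω : ℝ, ω₀ ≤ ω → ∀ ℓ : ℝ, 0 < ℓ → ∀ ρ : ℝ, 0 ≤ ρ → ∀ (L : ℝ) {q : ℝ},
      0 < q → ∀ {N : ℕ} (Ψ : TrialState N L),
        (∫⁻ z : Space, ∫⁻ X : Config N,
            ENNReal.ofReal (∑ i, ∑ j with i < j, χ (ℓ⁻¹ • (X i - z)) *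
            (Real.exp (-(ω / ℓ * ‖X i - X j‖)) / ‖X i - X j‖) * χ (ℓ⁻¹ • (X j - z))) * (‖Ψ.ψ X‖₊ : ℝ≥0∞) ^ 2) ≠ ⊤ ∧
        (∫⁻ z : Space, ∫⁻ X : Config N,
            ENNReal.ofReal (∑ i, ∫ y in box L, χ (ℓ⁻¹ • (X i - z)) *
            (Real.exp (-(ω / ℓ * ‖X i - y‖)) / ‖X i - y‖) * χ (ℓ⁻¹ • (y - z))) * (‖Ψ.ψ X‖₊ : ℝ≥0∞) ^ 2) ≠ ⊤ ∧
        (∫⁻ X, kineticDensity Ψ.ψ X).toReal +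
            q * ((∫ u, χ (ℓ⁻¹ • u) ^ 2)⁻¹ * (∫⁻ z : Space, ∫⁻ X : Config N,
            ENNReal.ofReal (∑ i, ∑ j with i < j, χ (ℓ⁻¹ • (X i - z)) *
            (Real.exp (-(ω / ℓ * ‖X i - X j‖)) / ‖X i - X j‖) * χ (ℓ⁻¹ • (X j - z))) * (‖Ψ.ψ X‖₊ : ℝ≥0∞) ^ 2).toReal -
              ρ * ((∫ u, χ (ℓ⁻¹ • u) ^ 2)⁻¹ * (∫⁻ z : Space, ∫⁻ X : Config N,
            ENNReal.ofReal (∑ i, ∫ y in box L, χ (ℓ⁻¹ • (X i - z)) *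
            (Real.exp (-(ω / ℓ * ‖X i - y‖)) / ‖X i - y‖) * χ (ℓ⁻¹ • (y - z))) * (‖Ψ.ψ X‖₊ : ℝ≥0∞) ^ 2).toReal) +
              ρ ^ 2 / 2 * ((∫ u, χ (ℓ⁻¹ • u) ^ 2)⁻¹ * ∫ z : Space, ∫ q in box L ×ˢ box L, χ (ℓ⁻¹ • (q.1 - z)) *
            (Real.exp (-(ω / ℓ * ‖q.1 - q.2‖)) / ‖q.1 - q.2‖) * χ (ℓ⁻¹ • (q.2 - z)) ∂(volume.prod volume))) -
            q * (1 / 2 * (ω / ℓ) * N) ≤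
          (chargedEnergy 0 q ρ Ψ).toReal - jelliumEnergyShift q ρ N L := by
  obtain ⟨ω₀, hω₀, H⟩ := lintegral_jelliumInteraction_ge_sliding hχ hsupp hχ0 hχnn
  refine ⟨ω₀, hω₀, fun ω hω ℓ hℓ ρ hρ L q hq N Ψ => ?_⟩
  have hfin : chargedEnergy 0 q ρ Ψ ≠ ⊤ := chargedEnergy_ne_top q hρ Ψ
  have hineq := H ω hω ℓ hℓ ρ hρ L Ψ
  have hν : 0 < ω / ℓ := div_pos (hω₀.trans_le hω) hℓ
  have hχℓ : Continuous fun x : Space => χ (ℓ⁻¹ • x) :=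
    hχ.continuous.comp (continuous_const_smul _)
  have hsuppℓ : HasCompactSupport fun x : Space => χ (ℓ⁻¹ • x) :=
    hsupp.comp_smul (inv_ne_zero hℓ.ne')
  -- positivity of `γ_ℓ`
  have hγpos : 0 < (∫ u, χ (ℓ⁻¹ • u) ^ 2)⁻¹ := by
    rw [integral_sq_comp_inv_smul χ hℓ]
    have h0 : 0 ≤ ∫ u, χ u ^ 2 := integral_nonneg fun u => sq_nonneg _
    have hpos : 0 < ∫ u, χ u ^ 2 := lt_of_le_of_ne h0 (Ne.symm hχ0)
    positivity
  -- finiteness of the Coulomb expectation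
  set P : ℝ≥0∞ := ∫⁻ X, jelliumInteraction ρ N L X * (‖Ψ.ψ X‖₊ : ℝ≥0∞) ^ 2 with hPdef
  have hkinE : energy 0 Ψ = ∫⁻ X, kineticDensity Ψ.ψ X := by simp [energy, interaction]
  have hcE : chargedEnergy 0 q ρ Ψ = (∫⁻ X, kineticDensity Ψ.ψ X) + ENNReal.ofReal q * P := by
    rw [chargedEnergy, hkinE]
  have hkin : (∫⁻ X, kineticDensity Ψ.ψ X) ≠ ⊤ := Ψ.lintegral_kineticDensity_lt_top.ne
  have hqP : ENNReal.ofReal q * P ≠ ⊤ := by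
    rw [hcE] at hfin
    exact (ENNReal.add_ne_top.1 hfin).2
  have hq0 : ENNReal.ofReal q ≠ 0 := by
    rw [Ne, ENNReal.ofReal_eq_zero, not_le]; exact hq
  have hP : P ≠ ⊤ := by
    intro hP
    rw [hP, ENNReal.mul_top hq0] at hqP
    exact hqP rfl
  -- finiteness of `I_PB`
  obtain ⟨M, hMr⟩ := hχ.continuous.norm.bddAbove_range_of_hasCompactSupport hsupp.norm
  have hM : ∀ x : Space, χ (ℓ⁻¹ • x) ≤ M := fun x =>
    (le_abs_self _).trans ((Real.norm_eq_abs _).symm.le.trans (hMr ⟨ℓ⁻¹ • x, rfl⟩))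
  set K : ℝ := N * (M * (∫ x : Space, Real.exp (-(ω / ℓ * ‖x‖)) / ‖x‖) *
    ∫ u, χ (ℓ⁻¹ • u)) with hKdef
  have hIPBle : (∫⁻ z : Space, ∫⁻ X : Config N,
            ENNReal.ofReal (∑ i, ∫ y in box L, χ (ℓ⁻¹ • (X i - z)) *
            (Real.exp (-(ω / ℓ * ‖X i - y‖)) / ‖X i - y‖) * χ (ℓ⁻¹ • (y - z))) * (‖Ψ.ψ X‖₊ : ℝ≥0∞) ^ 2) ≤ ENNReal.ofReal K := by
    -- Tonelli back to the `X`-outer form, then the uniform bound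
    have hw : Measurable fun X : Config N => (‖Ψ.ψ X‖₊ : ℝ≥0∞) ^ 2 :=
      (Ψ.contDiff.continuous.measurable.nnnorm.coe_nnreal_ennreal).pow_const _
    have hYm : Measurable fun x : Space => Real.exp (-(ω / ℓ * ‖x‖)) / ‖x‖ :=
      (Real.measurable_exp.comp (measurable_const.mul measurable_norm).neg).div measurable_norm
    have hm3 : ∀ i : Fin N, Measurable fun p : (Config N × Space) × Space => p.1.1 i - p.2 :=
      fun i => ((measurable_pi_apply i).comp (measurable_fst.comp measurable_fst)).sub measurable_snd
    have hm4 : Measurable fun p : (Config N × Space) × Space => ℓ⁻¹ • (p.2 - p.1.2) :=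
      (measurable_snd.sub (measurable_snd.comp measurable_fst)).const_smul ℓ⁻¹
    have hm5 : ∀ i : Fin N, Measurable fun p : (Config N × Space) × Space =>
        ℓ⁻¹ • (p.1.1 i - p.1.2) := fun i =>
      (((measurable_pi_apply i).comp (measurable_fst.comp measurable_fst)).sub
        (measurable_snd.comp measurable_fst)).const_smul ℓ⁻¹
    have hPBm : Measurable fun q : Config N × Space => ∑ i, ∫ y in box L, χ (ℓ⁻¹ • (q.1 i - q.2)) *
            (Real.exp (-(ω / ℓ * ‖q.1 i - y‖)) / ‖q.1 i - y‖) * χ (ℓ⁻¹ • (y - q.2)) := by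
      refine Finset.measurable_sum _ fun i _ => ?_
      have hf : Measurable fun p : (Config N × Space) × Space =>
          χ (ℓ⁻¹ • (p.1.1 i - p.1.2)) * (Real.exp (-(ω / ℓ * ‖p.1.1 i - p.2‖)) / ‖p.1.1 i - p.2‖) *
            χ (ℓ⁻¹ • (p.2 - p.1.2)) :=
        ((hχ.continuous.measurable.comp (hm5 i)).mul (hYm.comp (hm3 i))).mul
          (hχ.continuous.measurable.comp hm4)
      exact (hf.stronglyMeasurable.integral_prod_right' (ν := volume.restrict (box L))).measurable
    have hY0 : ∀ x : Space, 0 ≤ Real.exp (-(ω / ℓ * ‖x‖)) / ‖x‖ := fun x =>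
      div_nonneg (Real.exp_pos _).le (norm_nonneg _)
    have hPBnn : ∀ (X : Config N) (z : Space), 0 ≤ ∑ i, ∫ y in box L, χ (ℓ⁻¹ • (X i - z)) *
            (Real.exp (-(ω / ℓ * ‖X i - y‖)) / ‖X i - y‖) * χ (ℓ⁻¹ • (y - z)) := fun X z =>
      Finset.sum_nonneg fun i _ => setIntegral_nonneg (measurableSet_box L) fun y _ =>
        mul_nonneg (mul_nonneg (hχnn _) (hY0 _)) (hχnn _)
    have hPBi : ∀ X : Config N, Integrable fun z : Space => ∑ i, ∫ y in box L, χ (ℓ⁻¹ • (X i - z)) *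
            (Real.exp (-(ω / ℓ * ‖X i - y‖)) / ‖X i - y‖) * χ (ℓ⁻¹ • (y - z)) := fun X =>
      integrable_finsetSum _ fun i _ => integrable_sliding_pb_box hχℓ hsuppℓ hν L (X i)
    rw [lintegral_lintegral_swap (((hPBm.comp measurable_swap).ennreal_ofReal.mul
      (hw.comp measurable_snd)).aemeasurable)]
    calc ∫⁻ X : Config N, ∫⁻ z : Space, ENNReal.ofReal (∑ i, ∫ y in box L, χ (ℓ⁻¹ • (X i - z)) *
            (Real.exp (-(ω / ℓ * ‖X i - y‖)) / ‖X i - y‖) * χ (ℓ⁻¹ • (y - z))) * (‖Ψ.ψ X‖₊ : ℝ≥0∞) ^ 2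
        = ∫⁻ X : Config N, ENNReal.ofReal (∫ z : Space, ∑ i, ∫ y in box L, χ (ℓ⁻¹ • (X i - z)) *
            (Real.exp (-(ω / ℓ * ‖X i - y‖)) / ‖X i - y‖) * χ (ℓ⁻¹ • (y - z))) * (‖Ψ.ψ X‖₊ : ℝ≥0∞) ^ 2 := by
          refine lintegral_congr fun X => ?_
          rw [lintegral_mul_const' _ _ (ENNReal.pow_ne_top ENNReal.coe_ne_top),
            ← ofReal_integral_eq_lintegral_ofReal (hPBi X) (Eventually.of_forall (hPBnn X))]
      _ ≤ ∫⁻ X : Config N, ENNReal.ofReal K * (‖Ψ.ψ X‖₊ : ℝ≥0∞) ^ 2 := by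
          refine lintegral_mono fun X => mul_le_mul' (ENNReal.ofReal_le_ofReal ?_) le_rfl
          exact integral_sum_sliding_pb_le hχℓ hsuppℓ (fun x => hχnn _) hM hν L X
      _ = ENNReal.ofReal K := by
          rw [lintegral_const_mul' _ _ ENNReal.ofReal_ne_top, Ψ.norm_eq, mul_one]
  have hIPB : (∫⁻ z : Space, ∫⁻ X : Config N,
            ENNReal.ofReal (∑ i, ∫ y in box L, χ (ℓ⁻¹ • (X i - z)) *
            (Real.exp (-(ω / ℓ * ‖X i - y‖)) / ‖X i - y‖) * χ (ℓ⁻¹ • (y - z))) * (‖Ψ.ψ X‖₊ : ℝ≥0∞) ^ 2) ≠ ⊤ := ne_top_of_le_ne_top ENNReal.ofReal_ne_top hIPBle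
  -- finiteness of the right side, hence of `I_PP`
  have hB : ENNReal.ofReal (ρ * (∫ u, χ (ℓ⁻¹ • u) ^ 2)⁻¹) * (∫⁻ z : Space, ∫⁻ X : Config N,
            ENNReal.ofReal (∑ i, ∫ y in box L, χ (ℓ⁻¹ • (X i - z)) *
            (Real.exp (-(ω / ℓ * ‖X i - y‖)) / ‖X i - y‖) * χ (ℓ⁻¹ • (y - z))) * (‖Ψ.ψ X‖₊ : ℝ≥0∞) ^ 2) ≠ ⊤ := ENNReal.mul_ne_top ENNReal.ofReal_ne_top hIPB
  have hRHS : P + ENNReal.ofReal (ρ * (∫ u, χ (ℓ⁻¹ • u) ^ 2)⁻¹) * (∫⁻ z : Space, ∫⁻ X : Config N,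
            ENNReal.ofReal (∑ i, ∫ y in box L, χ (ℓ⁻¹ • (X i - z)) *
            (Real.exp (-(ω / ℓ * ‖X i - y‖)) / ‖X i - y‖) * χ (ℓ⁻¹ • (y - z))) * (‖Ψ.ψ X‖₊ : ℝ≥0∞) ^ 2) +
      ENNReal.ofReal (1 / 2 * (ω / ℓ) * N) + ENNReal.ofReal (-(ρ ^ 2 / 2 * ((∫ u, χ (ℓ⁻¹ • u) ^ 2)⁻¹ * ∫ z : Space, ∫ q in box L ×ˢ box L, χ (ℓ⁻¹ • (q.1 - z)) *
            (Real.exp (-(ω / ℓ * ‖q.1 - q.2‖)) / ‖q.1 - q.2‖) * χ (ℓ⁻¹ • (q.2 - z)) ∂(volume.prod volume)) +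
            jelliumEnergyShift 1 ρ N L)) ≠ ⊤ :=
    ENNReal.add_ne_top.2 ⟨ENNReal.add_ne_top.2 ⟨ENNReal.add_ne_top.2 ⟨hP, hB⟩,
      ENNReal.ofReal_ne_top⟩, ENNReal.ofReal_ne_top⟩
  have hLHS : ENNReal.ofReal (∫ u, χ (ℓ⁻¹ • u) ^ 2)⁻¹ * (∫⁻ z : Space, ∫⁻ X : Config N,
            ENNReal.ofReal (∑ i, ∑ j with i < j, χ (ℓ⁻¹ • (X i - z)) *
            (Real.exp (-(ω / ℓ * ‖X i - X j‖)) / ‖X i - X j‖) * χ (ℓ⁻¹ • (X j - z))) * (‖Ψ.ψ X‖₊ : ℝ≥0∞) ^ 2) + ENNReal.ofReal (ρ ^ 2 / 2 * ((∫ u, χ (ℓ⁻¹ • u) ^ 2)⁻¹ * ∫ z : Space, ∫ q in box L ×ˢ box L, χ (ℓ⁻¹ • (q.1 - z)) *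
            (Real.exp (-(ω / ℓ * ‖q.1 - q.2‖)) / ‖q.1 - q.2‖) * χ (ℓ⁻¹ • (q.2 - z)) ∂(volume.prod volume)) +
            jelliumEnergyShift 1 ρ N L) ≠ ⊤ :=
    ne_top_of_le_ne_top hRHS hineq
  have hA : ENNReal.ofReal (∫ u, χ (ℓ⁻¹ • u) ^ 2)⁻¹ * (∫⁻ z : Space, ∫⁻ X : Config N,
            ENNReal.ofReal (∑ i, ∑ j with i < j, χ (ℓ⁻¹ • (X i - z)) *
            (Real.exp (-(ω / ℓ * ‖X i - X j‖)) / ‖X i - X j‖) * χ (ℓ⁻¹ • (X j - z))) * (‖Ψ.ψ X‖₊ : ℝ≥0∞) ^ 2) ≠ ⊤ := (ENNReal.add_ne_top.1 hLHS).1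
  have hγ0' : ENNReal.ofReal (∫ u, χ (ℓ⁻¹ • u) ^ 2)⁻¹ ≠ 0 := by
    rw [Ne, ENNReal.ofReal_eq_zero, not_le]; exact hγpos
  have hIPP : (∫⁻ z : Space, ∫⁻ X : Config N,
            ENNReal.ofReal (∑ i, ∑ j with i < j, χ (ℓ⁻¹ • (X i - z)) *
            (Real.exp (-(ω / ℓ * ‖X i - X j‖)) / ‖X i - X j‖) * χ (ℓ⁻¹ • (X j - z))) * (‖Ψ.ψ X‖₊ : ℝ≥0∞) ^ 2) ≠ ⊤ := by
    intro h
    rw [h, ENNReal.mul_top hγ0'] at hA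
    exact hA rfl
  refine ⟨hIPP, hIPB, ?_⟩
  -- pass to real numbers
  have hreal := (ENNReal.toReal_le_toReal hLHS hRHS).2 hineq
  rw [ENNReal.toReal_add hA ENNReal.ofReal_ne_top, ENNReal.toReal_mul,
    ENNReal.toReal_ofReal hγpos.le, ENNReal.toReal_ofReal',
    ENNReal.toReal_add (ENNReal.add_ne_top.2 ⟨ENNReal.add_ne_top.2 ⟨hP, hB⟩,
      ENNReal.ofReal_ne_top⟩) ENNReal.ofReal_ne_top,
    ENNReal.toReal_add (ENNReal.add_ne_top.2 ⟨hP, hB⟩) ENNReal.ofReal_ne_top,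
    ENNReal.toReal_add hP hB, ENNReal.toReal_mul,
    ENNReal.toReal_ofReal (mul_nonneg hρ hγpos.le),
    ENNReal.toReal_ofReal (by positivity : (0 : ℝ) ≤ 1 / 2 * (ω / ℓ) * N),
    ENNReal.toReal_ofReal'] at hreal
  have hmax : max (ρ ^ 2 / 2 * ((∫ u, χ (ℓ⁻¹ • u) ^ 2)⁻¹ * ∫ z : Space, ∫ q in box L ×ˢ box L, χ (ℓ⁻¹ • (q.1 - z)) *
            (Real.exp (-(ω / ℓ * ‖q.1 - q.2‖)) / ‖q.1 - q.2‖) * χ (ℓ⁻¹ • (q.2 - z)) ∂(volume.prod volume)) +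
            jelliumEnergyShift 1 ρ N L) 0 - max (-(ρ ^ 2 / 2 * ((∫ u, χ (ℓ⁻¹ • u) ^ 2)⁻¹ * ∫ z : Space, ∫ q in box L ×ˢ box L, χ (ℓ⁻¹ • (q.1 - z)) *
            (Real.exp (-(ω / ℓ * ‖q.1 - q.2‖)) / ‖q.1 - q.2‖) * χ (ℓ⁻¹ • (q.2 - z)) ∂(volume.prod volume)) +
            jelliumEnergyShift 1 ρ N L)) 0 = ρ ^ 2 / 2 * ((∫ u, χ (ℓ⁻¹ • u) ^ 2)⁻¹ * ∫ z : Space, ∫ q in box L ×ˢ box L, χ (ℓ⁻¹ • (q.1 - z)) *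
            (Real.exp (-(ω / ℓ * ‖q.1 - q.2‖)) / ‖q.1 - q.2‖) * χ (ℓ⁻¹ • (q.2 - z)) ∂(volume.prod volume)) +
            jelliumEnergyShift 1 ρ N L := by
    rcases le_total 0 (ρ ^ 2 / 2 * ((∫ u, χ (ℓ⁻¹ • u) ^ 2)⁻¹ * ∫ z : Space, ∫ q in box L ×ˢ box L, χ (ℓ⁻¹ • (q.1 - z)) *
            (Real.exp (-(ω / ℓ * ‖q.1 - q.2‖)) / ‖q.1 - q.2‖) * χ (ℓ⁻¹ • (q.2 - z)) ∂(volume.prod volume)) +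
            jelliumEnergyShift 1 ρ N L) with h | h
    · rw [max_eq_left h, max_eq_right (neg_nonpos.2 h)]
      ring
    · rw [max_eq_right h, max_eq_left (neg_nonneg.2 h)]
      ring
  -- the energy identity
  have hE : (chargedEnergy 0 q ρ Ψ).toReal = (∫⁻ X, kineticDensity Ψ.ψ X).toReal + q * P.toReal := by
    rw [hcE, ENNReal.toReal_add hkin hqP, ENNReal.toReal_mul, ENNReal.toReal_ofReal hq.le]
  have hshift : jelliumEnergyShift q ρ N L = q * jelliumEnergyShift 1 ρ N L := by
    simp only [jelliumEnergyShift]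
    ring
  rw [hE, hshift]
  have key := mul_le_mul_of_nonneg_left (show (∫ u, χ (ℓ⁻¹ • u) ^ 2)⁻¹ * (∫⁻ z : Space, ∫⁻ X : Config N,
            ENNReal.ofReal (∑ i, ∑ j with i < j, χ (ℓ⁻¹ • (X i - z)) *
            (Real.exp (-(ω / ℓ * ‖X i - X j‖)) / ‖X i - X j‖) * χ (ℓ⁻¹ • (X j - z))) * (‖Ψ.ψ X‖₊ : ℝ≥0∞) ^ 2).toReal + (ρ ^ 2 / 2 * ((∫ u, χ (ℓ⁻¹ • u) ^ 2)⁻¹ * ∫ z : Space, ∫ q in box L ×ˢ box L, χ (ℓ⁻¹ • (q.1 - z)) *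
            (Real.exp (-(ω / ℓ * ‖q.1 - q.2‖)) / ‖q.1 - q.2‖) * χ (ℓ⁻¹ • (q.2 - z)) ∂(volume.prod volume)) +
            jelliumEnergyShift 1 ρ N L) ≤
      P.toReal + ρ * (∫ u, χ (ℓ⁻¹ • u) ^ 2)⁻¹ * (∫⁻ z : Space, ∫⁻ X : Config N,
            ENNReal.ofReal (∑ i, ∫ y in box L, χ (ℓ⁻¹ • (X i - z)) *
            (Real.exp (-(ω / ℓ * ‖X i - y‖)) / ‖X i - y‖) * χ (ℓ⁻¹ • (y - z))) * (‖Ψ.ψ X‖₊ : ℝ≥0∞) ^ 2).toReal + 1 / 2 * (ω / ℓ) * N by linarith) hq.le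
  nlinarith [key]

end Sliding

end Literature.MathematicalPhysics.QuantumManyBody.JelliumBoseGas
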